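import Summits.KontsevichZagierPeriods.KontsevichZagierPeriods.Theorems.HurwitzMicroSectorsNormalFormPrincipleLevelOne
import Summits.KontsevichZagierPeriods.KontsevichZagierPeriods.Theorems.HurwitzMicroSectorsNormalFormPrincipleSlabASubPtK20
import Summits.KontsevichZagierPeriods.KontsevichZagierPeriods.Theorems.HurwitzMicroSectorsNormalFormPrincipleAlgCarriers
import Summits.KontsevichZagierPeriods.KontsevichZagierPeriods.Theorems.HurwitzMicroSectorsNormalFormPrincipleM2FiveZetaTwo
import Literature.NumberTheory.Transcendental.BoxIntegralZetaValues

/-!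
# `NormalFormPrinciple` (stmt-KontsevichZagierPeriods-3869), line `SketchIdeator1` — leaf `stub_boxRigidity`:
# the even zeta values layer: a constant box loses its last dimension (rule 3)

Registered sub-goal `constBox_sub_pred` of the layer "the even zeta values
`[(0,1)^{2k}, P(x₀⋯x_{2k−1})/(1 − x₀⋯x_{2k−1})]`" (lead file `…EvenZeta`): for a real-algebraic
constant `c`, the constant box representations `N = [(0,1)^{n+1}, c]` and `N' = [(0,1)^n, c]`
differ by a relation of the Kontsevich–Zagier calculus. We build the intermediate representation
`r = [B, c]` on the closed-fibre band-box `B = {z | (z_0,…,z_{n-1}) ∈ (0,1)^n, 0 ≤ z_n ≤ 1}` over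
the base `(0,1)^n = N'.domain` (constant integrand: `ℚ`-semialgebraic because `c` is algebraic,
integrable because `B` is the open box plus the two null faces `{z_n = 0}`, `{z_n = 1}`). Then

1. (rule 1) `[N] − [r]`: `N.domain = (0,1)^{n+1} ⊆ B`, `B ∖ (0,1)^{n+1}` is null
   (`Measure.pi_hyperplane`), so `[B, c] − [(0,1)^{n+1}, c] ∈ relations`
   (`KZ.IntegralRep.of_sub_of_restrict_mem_relations`) and `[N] − [(0,1)^{n+1}, c]` is a congruence
   (`KZ.of_sub_of_mem_relations_of_eqOn`);
2. (rule 3) `[r] − [N']` is ONE Newton–Leibniz move (`KZ.newtonLeibnizRel`) along the last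
   coordinate over `(0,1)^n` with edges `0 ≤ 1` and primitive `F(z) = c · z_n`:
   `∂F/∂z_n = c = r.integrand`, `F(x,1) − F(x,0) = c = N'.integrand x` on `(0,1)^n`.

For `n = 0` the base `(0,1)^0 = {pt}` and `N'` is the point representation `[pt, c]`.
References: M. Kontsevich, D. Zagier, *Periods* (2001), §1.2 rules (1), (3). No new definitions.
-/

noncomputable section

open MeasureTheory Set
open Literature.NumberTheory.Transcendental Literature.NumberTheory.Transcendental.KZ
open Literature.ModelTheory.ExponentialFields (IsSemialgebraic)

namespace Summit.KontsevichZagierPeriods.HurwitzMicroSectors.NormalFormPrinciple.PiBox.EvenZeta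

/-- The closed-fibre band-box `{z | init z ∈ (0,1)ⁿ, 0 ≤ z_n ≤ 1}` is contained in the open box
`(0,1)^{n+1}` together with the two faces `{z_n = 0}`, `{z_n = 1}`. [folklore] -/
theorem ez_bandBox_subset_box_union_faces (n : ℕ) :
    KZlog.band {y : Fin n → ℝ | ∀ i, y i ∈ Set.Ioo (0:ℝ) 1} (fun _ => (0:ℝ)) (fun _ => (1:ℝ)) ⊆
      {x : Fin (n + 1) → ℝ | ∀ i, x i ∈ Set.Ioo (0:ℝ) 1} ∪
        ({z | z (Fin.last n) = 0} ∪ {z | z (Fin.last n) = 1}) := by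
  intro z hz
  have hmem : (∀ i : Fin n, z (Fin.castSucc i) ∈ Ioo (0:ℝ) 1) ∧ 0 ≤ z (Fin.last n) ∧
      z (Fin.last n) ≤ 1 := ⟨hz.1, hz.2.1, hz.2.2⟩
  obtain ⟨hcs, h0, h1⟩ := hmem
  rcases h0.eq_or_lt with h0 | h0
  · exact Or.inr (Or.inl h0.symm)
  rcases h1.lt_or_eq with h1 | h1
  · refine Or.inl ?_
    rw [Set.mem_setOf_eq]
    intro i
    induction i using Fin.lastCases with
    | last => exact ⟨h0, h1⟩
    | cast j => exact hcs j
  · exact Or.inr (Or.inr h1)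

/-- The closed-fibre band-box differs from the open box `(0,1)^{n+1}` by a null set (the two faces
`{z_n = 0}`, `{z_n = 1}` are null, `Measure.pi_hyperplane`). [folklore] -/
theorem ez_volume_bandBox_diff_box (n : ℕ) :
    volume (KZlog.band {y : Fin n → ℝ | ∀ i, y i ∈ Set.Ioo (0:ℝ) 1} (fun _ => (0:ℝ))
      (fun _ => (1:ℝ)) \ {x : Fin (n + 1) → ℝ | ∀ i, x i ∈ Set.Ioo (0:ℝ) 1}) = 0 := by
  refine measure_mono_null (fun z hz => ?_)
    (measure_union_null (volume_setOf_last_eq_zero (n := n) 0)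
      (volume_setOf_last_eq_zero (n := n) 1))
  rcases ez_bandBox_subset_box_union_faces n hz.1 with h | h
  · exact absurd h hz.2
  · exact h

/-- The open box `(0,1)^{n+1}` lies in the closed-fibre band-box over `(0,1)ⁿ`. [folklore] -/
theorem ez_box_subset_bandBox (n : ℕ) :
    {x : Fin (n + 1) → ℝ | ∀ i, x i ∈ Set.Ioo (0:ℝ) 1} ⊆
      KZlog.band {y : Fin n → ℝ | ∀ i, y i ∈ Set.Ioo (0:ℝ) 1} (fun _ => (0:ℝ)) (fun _ => (1:ℝ)) :=
  fun _ hz => ⟨fun i => hz (Fin.castSucc i), (hz (Fin.last n)).1.le, (hz (Fin.last n)).2.le⟩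

/-- **Existence of the intermediate representation `[B, c]`** on the closed-fibre band-box
`B = {z | init z ∈ (0,1)ⁿ, 0 ≤ z_n ≤ 1}` with the algebraic constant integrand `c`, given that `c`
is integrable on the open box `(0,1)^{n+1}` (the band-box is `ℚ`-semialgebraic by
`KZlog.isSemialgebraic_band`, the constant is `ℚ`-semialgebraic by
`isSemialgebraicFunOn_const_of_isAlgebraic`, and integrability passes to `B` through the two null
faces). [cite: KontsevichZagier2001, §1.1] -/
theorem ez_exists_constBandBox (n : ℕ) {c : ℝ} (hc : IsAlgebraic ℚ c)
    (hint : IntegrableOn (fun _ : Fin (n + 1) → ℝ => c)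
      {x : Fin (n + 1) → ℝ | ∀ i, x i ∈ Set.Ioo (0:ℝ) 1}) :
    ∃ r : IntegralRep (n + 1),
      r.domain = KZlog.band {y : Fin n → ℝ | ∀ i, y i ∈ Set.Ioo (0:ℝ) 1} (fun _ => (0:ℝ))
        (fun _ => (1:ℝ)) ∧ r.integrand = fun _ => c := by
  have hG : IsSemialgebraic ℚ {y : Fin n → ℝ | ∀ i, y i ∈ Set.Ioo (0:ℝ) 1} :=
    isSemialgebraic_box n
  have ha : IsSemialgebraicFunOn ℚ {y : Fin n → ℝ | ∀ i, y i ∈ Set.Ioo (0:ℝ) 1}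
      (fun _ => (0:ℝ)) := by
    simpa using isSemialgebraicFunOn_ratCast hG 0
  have hb : IsSemialgebraicFunOn ℚ {y : Fin n → ℝ | ∀ i, y i ∈ Set.Ioo (0:ℝ) 1}
      (fun _ => (1:ℝ)) := by
    simpa using isSemialgebraicFunOn_ratCast hG 1
  have hB : IsSemialgebraic ℚ (KZlog.band {y : Fin n → ℝ | ∀ i, y i ∈ Set.Ioo (0:ℝ) 1}
      (fun _ => (0:ℝ)) (fun _ => (1:ℝ))) :=
    KZlog.isSemialgebraic_band ha hb
  have hsa : IsSemialgebraicFunOn ℚ (KZlog.band {y : Fin n → ℝ | ∀ i, y i ∈ Set.Ioo (0:ℝ) 1}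
      (fun _ => (0:ℝ)) (fun _ => (1:ℝ))) (fun _ => c) :=
    isSemialgebraicFunOn_const_of_isAlgebraic hB hc
  have hint' : IntegrableOn (fun _ : Fin (n + 1) → ℝ => c)
      (KZlog.band {y : Fin n → ℝ | ∀ i, y i ∈ Set.Ioo (0:ℝ) 1} (fun _ => (0:ℝ))
        (fun _ => (1:ℝ))) :=
    (hint.union ((IntegrableOn.of_measure_zero (volume_setOf_last_eq_zero 0)).union
      (IntegrableOn.of_measure_zero (volume_setOf_last_eq_zero 1)))).mono_set
      (ez_bandBox_subset_box_union_faces n)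
  exact ⟨⟨_, _, hB, hsa, hint'⟩, rfl, rfl⟩

/-- **The Newton–Leibniz move for a constant integrand (rule 3).** If `r = [B, c]` is the constant
representation on the closed-fibre band-box `B = {z | init z ∈ G, 0 ≤ z_n ≤ 1}` over the domain
`G` of a representation `N'` whose integrand is the same algebraic constant `c` on `G`, then
`[r] − [N']` is ONE Newton–Leibniz relation along the last coordinate, with the primitive
`F(z) = c · z_n` (`ℚ`-semialgebraic on `B`: algebraic constant times a coordinate), edges `0 ≤ 1`:
`∂F/∂z_n = c` on the open fibre and `F(x,1) − F(x,0) = c = N'.integrand x` on `G`.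
[cite: KontsevichZagier2001, §1.2 rule (3)] -/
theorem ez_constBandBox_sub_base {n : ℕ} {c : ℝ} (hc : IsAlgebraic ℚ c) (r : IntegralRep (n + 1))
    (N' : IntegralRep n) (hrd : r.domain = KZlog.band N'.domain (fun _ => (0:ℝ)) (fun _ => (1:ℝ)))
    (hri : r.integrand = fun _ => c) (hN'i : EqOn N'.integrand (fun _ => c) N'.domain) :
    of r - of N' ∈ relations := by
  have hG : IsSemialgebraic ℚ N'.domain := N'.isSemialgebraic_domain
  have ha : IsSemialgebraicFunOn ℚ N'.domain (fun _ => (0:ℝ)) := by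
    simpa using isSemialgebraicFunOn_ratCast hG 0
  have hb : IsSemialgebraicFunOn ℚ N'.domain (fun _ => (1:ℝ)) := by
    simpa using isSemialgebraicFunOn_ratCast hG 1
  have hB : IsSemialgebraic ℚ r.domain := r.isSemialgebraic_domain
  refine newtonLeibnizRel_subset_relations ⟨n, r, N', fun _ => (0:ℝ), fun _ => (1:ℝ),
    fun z => c * z (Fin.last n), ?_, ha, hb, fun _ _ => zero_le_one, ?_, ?_, ?_, ?_, rfl⟩
  · -- the primitive `c · z_n`: algebraic constant times the last coordinate
    exact (IsSemialgebraicFunOn.mul_holds (isSemialgebraicFunOn_const_of_isAlgebraic hB hc)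
      (isSemialgebraicFunOn_apply hB (Fin.last n))).congr fun z _ => rfl
  · -- the band over `G` with edges `0 ≤ z_n ≤ 1`
    rw [hrd]
    rfl
  · -- continuity of the primitive on the closed fibre
    intro x _
    simp only [Fin.snoc_last]
    exact (continuous_const_mul c).continuousOn
  · -- its derivative on the open fibre is the (constant) integrand of `r`
    intro x _ t _
    rw [hri]
    simp only [Fin.snoc_last]
    exact hasDerivAt_const_mul c
  · -- the endpoint difference `c · 1 − c · 0 = c = N'.integrand x`
    intro x hx
    rw [hN'i hx]
    simp only [Fin.snoc_last, mul_one, mul_zero, sub_zero]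

/-- **Stub Z2 (a constant box loses a dimension, rule 3; registered sub-goal of the even zeta
values layer of `stub_boxRigidity`).** For a real-algebraic constant `c`, the constant box
representations `N = [(0,1)^{n+1}, c]` and `N' = [(0,1)^n, c]` differ by a relation of the
Kontsevich–Zagier calculus: `N` is congruent, up to the two null faces `{z_n = 0}`, `{z_n = 1}`
(rule 1, `KZ.IntegralRep.of_sub_of_restrict_mem_relations`, `KZ.of_sub_of_mem_relations_of_eqOn`),
to the constant representation `[B, c]` on the closed-fibre band-box
`B = {z | init z ∈ (0,1)ⁿ, 0 ≤ z_n ≤ 1}`, and `[B, c] − [N']` is one Newton–Leibniz move along the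
last coordinate with the primitive `F = c · z_n` (rule 3). For `n = 0` the target is the point
representation `[pt, c]` (`{x : Fin 0 → ℝ | ∀ i, …} = univ`).
[cite: KontsevichZagier2001, §1.2 rules (1), (3)] -/
theorem constBox_sub_pred (n : ℕ) (c : ℝ) (hc : IsAlgebraic ℚ c) (N : IntegralRep (n + 1))
    (N' : IntegralRep n) (hNd : N.domain = {x | ∀ i, x i ∈ Set.Ioo (0:ℝ) 1})
    (hNi : EqOn N.integrand (fun _ => c) N.domain) (hN'd : N'.domain = {x | ∀ i, x i ∈ Set.Ioo (0:ℝ) 1})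
    (hN'i : EqOn N'.integrand (fun _ => c) N'.domain) :
    of N - of N' ∈ relations := by
  -- the constant `c` is integrable on the open box (it is `N.integrand` there)
  have hNint : IntegrableOn (fun _ : Fin (n + 1) → ℝ => c)
      {x : Fin (n + 1) → ℝ | ∀ i, x i ∈ Set.Ioo (0:ℝ) 1} :=
    hNd ▸ N.integrableOn.congr_fun hNi (IntegralRep.measurableSet_domain_holds N)
  -- the intermediate representation `r = [B, c]` on the closed-fibre band-box over `(0,1)ⁿ`
  obtain ⟨r, hrd, hri⟩ := ez_exists_constBandBox n hc hNint
  -- (rule 1) `N` versus `r`: restriction to the open box (null faces) and congruence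
  have hEr : N.domain ⊆ r.domain := by
    rw [hNd, hrd]
    exact ez_box_subset_bandBox n
  have hnull : volume (r.domain \ N.domain) = 0 := by
    rw [hNd, hrd]
    exact ez_volume_bandBox_diff_box n
  have e1 : of r - of (r.restrict N.domain N.isSemialgebraic_domain hEr) ∈ relations :=
    r.of_sub_of_restrict_mem_relations N.isSemialgebraic_domain hEr hnull
  have e2 : of N - of (r.restrict N.domain N.isSemialgebraic_domain hEr) ∈ relations :=
    of_sub_of_mem_relations_of_eqOn rfl (by rw [IntegralRep.integrand_restrict, hri]; exact hNi)
  -- (rule 3) `r` versus `N'`: ONE Newton–Leibniz move along the last coordinate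
  have e3 : of r - of N' ∈ relations :=
    ez_constBandBox_sub_base hc r N' (by rw [hrd, hN'd]) hri hN'i
  -- bookkeeping in `FormalRep ⧸ relations`
  have e : of N - of N' = (of N - of (r.restrict N.domain N.isSemialgebraic_domain hEr)) -
      (of r - of (r.restrict N.domain N.isSemialgebraic_domain hEr)) + (of r - of N') := by
    abel
  rw [e]
  exact relations.add_mem (relations.sub_mem e2 e1) e3

end Summit.KontsevichZagierPeriods.HurwitzMicroSectors.NormalFormPrinciple.PiBox.EvenZeta
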